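import Summits.Ventures.HodgeRepro2.T6A2Main
import Summits.Ventures.HodgeRepro2.T6A3Model
import Summits.Ventures.HodgeRepro2.T6A3Main

/-!
# T6A2Inputs — A2's M1 handle in the composition contract's vocabulary (t6-lead, STATUS l. 4494):
the F-compatible algebraic (1,1)-class θ indexed by an `EigenBasis` of t6-p3's model

Cell pub-hodge-repro2, Tier 6 (README §10), seat t6-p2 (A2 owner). Proof lane. Re-indexes `A2Main.exists_theta`
(embeddings through `Gal(K/ℚ)` and a base embedding) to an `A3Model.EigenBasis E` (embeddings through
`E.emb : Fin 3 × Bool ≃ (K →+* ℂ)`): with `τ₁ := E.emb (0, false)`, `exists_emb_eq` writes every `E.emb (ν, false)`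
as `τ₁ ∘ g_ν`, and the conjugate-pairing hypothesis `E.emb (ν, true) = conjugate (E.emb (ν, false))`
(`hconj`, the one fact the contract's `E` must carry for θ to be of type (1,1)) identifies `E.emb (ν, true)`
with `τ₁ ∘ (cc ∘ g_ν)` (`conjugate_emb`). The generator binders come from `heB` / `hne` / `hspan`.

* `A2_inputs_sum` — the handle in A2's sum form (planes `ι(single i a_ν) ∧ ι(single i b_ν)`,
  `a_ν = eK (E.emb (ν, false))`, `b_ν = eK (E.emb (ν, true))`), exactly the left side of t6-p3's dictionary
  `A3Main.theta_eq_of_eigenBasis`;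
* `A2_inputs` — the handle in A3_main's vocabulary `extC K θ = modelEquiv E (theta c)`.
No `sorry`; standard axioms.
§8(d): uses an L-value-free non-vanishing device: NO.
-/

namespace Summit.Ventures.HodgeRepro2.T6.A2Inputs

open Summit.Ventures.HodgeRepro2.T6 Summit.Ventures.HodgeRepro2.T6.A2Conj
  Summit.Ventures.HodgeRepro2.T6.A2Theta Summit.Ventures.HodgeRepro2.T6.A2Main
  Summit.Ventures.HodgeRepro2.T6.A3Model Summit.Ventures.HodgeRepro2.T6.A3Main NumberField

variable {K : Type*} [Field K] [NumberField K] [IsCMField K] [IsGalois ℚ K]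

omit [IsCMField K] [IsGalois ℚ K] in
/-- The eigenvector `eK σ` of the eigenbasis lies on the `σ`-eigenline of `K ⊗ ℂ`
(from `E.eigen`: `ℓ_{i,σ} = ℂ · eB (i, σ)` and `eB (i, σ) = single i (eK σ)`). -/
theorem eK_mem_eigenLineK (E : EigenBasis K) (eK : (K →+* ℂ) → KC K)
    (heB : ∀ (i : Fin 4) (σ : K →+* ℂ), E.eB (i, σ) = LinearMap.single ℂ (fun _ => KC K) i (eK σ))
    (σ : K →+* ℂ) : eK σ ∈ eigenLineK K σ := by
  have h : LinearMap.single ℂ (fun _ => KC K) (0 : Fin 4) (eK σ) ∈ eigenLine K 0 σ := by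
    rw [E.eigen 0 σ, heB]
    exact Submodule.mem_span_singleton_self _
  obtain ⟨w, hw, hw'⟩ := Submodule.mem_map.mp h
  have : w = eK σ := by
    have := congrArg (fun f => f (0 : Fin 4)) hw'
    simpa using this
  rw [← this]; exact hw

/-- A2's M1 HANDLE, sum form (STATUS l. 4494, A2_inputs): for an eigenbasis `E` whose embedding coordinates are
conjugate-paired and whose vectors are `single i (eK σ)` with `eK σ ≠ 0` spanning `K ⊗ ℂ`, there is
`θ ∈ D.Alg 1` with `extC θ = Σ_{i,ν} c_{i,ν} ι(single i (eK (E.emb (ν,false)))) ∧ ι(single i (eK (E.emb (ν,true))))`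
and every `c_{i,ν} ≠ 0` (TIER4 (S2)). -/
theorem A2_inputs_sum {F : FaceSetting K} (D : TransferShadow F) (E : EigenBasis K)
    (hconj : ∀ ν : Fin 3, E.emb (ν, true) = ComplexEmbedding.conjugate (E.emb (ν, false)))
    (eK : (K →+* ℂ) → KC K)
    (heB : ∀ (i : Fin 4) (σ : K →+* ℂ), E.eB (i, σ) = LinearMap.single ℂ (fun _ => KC K) i (eK σ))
    (hne : ∀ σ, eK σ ≠ 0) (hspan : Submodule.span ℂ (Set.range eK) = ⊤) :
    ∃ θ ∈ D.Alg 1, ∃ c : Fin 4 → Fin 3 → ℂ, (∀ i ν, c i ν ≠ 0) ∧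
      extC K θ = ∑ i : Fin 4, ∑ ν : Fin 3, c i ν •
        (ExteriorAlgebra.ι ℂ (LinearMap.single ℂ (fun _ => KC K) i (eK (E.emb (ν, false)))) *
          ExteriorAlgebra.ι ℂ (LinearMap.single ℂ (fun _ => KC K) i (eK (E.emb (ν, true))))) := by
  classical
  set τ₁ : K →+* ℂ := E.emb (0, false) with hτ₁
  -- the half-system through Gal(K/ℚ)
  choose τ hτ using fun ν : Fin 3 => exists_emb_eq K τ₁ (E.emb (ν, false))
  have hτbar : ∀ ν, emb K τ₁ ((cc K).trans (τ ν)) = E.emb (ν, true) := by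
    intro ν
    rw [hconj, ← conjugate_emb, ← hτ ν]
  -- the generators indexed by Gal(K/ℚ)
  let e : (K ≃ₐ[ℚ] K) → KC K := fun g => eK (emb K τ₁ g)
  have he : ∀ g, e g ∈ eigenLineK K (emb K τ₁ g) := fun g => eK_mem_eigenLineK E eK heB _
  have hne' : ∀ g, e g ≠ 0 := fun g => hne _
  have hspan' : Submodule.span ℂ (Set.range e) = ⊤ := by
    rw [← hspan]
    congr 1
    ext v
    constructor
    · rintro ⟨g, rfl⟩; exact ⟨_, rfl⟩
    · rintro ⟨σ, rfl⟩
      obtain ⟨g, rfl⟩ := exists_emb_eq K τ₁ σ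
      exact ⟨g, rfl⟩
  have hτcov : ∀ g, ∃ ν, g = τ ν ∨ g = (cc K).trans (τ ν) := by
    intro g
    obtain ⟨⟨ν, s⟩, hs⟩ := E.emb.surjective (emb K τ₁ g)
    refine ⟨ν, ?_⟩
    cases s
    · left
      apply emb_injective K τ₁
      rw [← hτ ν, hs]
    · right
      apply emb_injective K τ₁
      rw [hτbar ν, hs]
  have hτdist : ∀ ν ν', τ ν' = τ ν ∨ τ ν' = (cc K).trans (τ ν) → ν' = ν := by
    intro ν ν' h
    rcases h with h | h
    · have := hτ ν'
      rw [h, ← hτ ν] at this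
      have h2 : (ν', false) = (ν, false) := E.emb.injective this
      exact (Prod.mk.inj h2).1
    · have := hτ ν'
      rw [h, hτbar ν] at this
      have h2 : (ν', false) = (ν, true) := E.emb.injective this
      exact absurd (Prod.mk.inj h2).2 Bool.noConfusion
  obtain ⟨θ, hθ, -, c, hc, hext⟩ := exists_theta K τ₁ F D e he hne' hspan' τ hτcov hτdist
  refine ⟨θ, hθ, c, hc, ?_⟩
  rw [hext]
  refine Finset.sum_congr rfl fun i _ => Finset.sum_congr rfl fun ν _ => ?_
  simp only [planeGen, gen1C, e, hτ ν, hτbar ν]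


/-- A2's M1 HANDLE in `A3_main`'s vocabulary (STATUS l. 4494, `A2_inputs`): `θ ∈ D.Alg 1` with
`extC θ = modelEquiv E (theta c)`, every `c p ≠ 0` — `A2_inputs_sum` through t6-p3's dictionary
`theta_eq_of_eigenBasis`. -/
theorem A2_inputs {F : FaceSetting K} (D : TransferShadow F) (E : EigenBasis K)
    (hconj : ∀ ν : Fin 3, E.emb (ν, true) = ComplexEmbedding.conjugate (E.emb (ν, false)))
    (eK : (K →+* ℂ) → KC K)
    (heB : ∀ (i : Fin 4) (σ : K →+* ℂ), E.eB (i, σ) = LinearMap.single ℂ (fun _ => KC K) i (eK σ))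
    (hne : ∀ σ, eK σ ≠ 0) (hspan : Submodule.span ℂ (Set.range eK) = ⊤) :
    ∃ θ ∈ D.Alg 1, ∃ c : Pl → ℂ, (∀ p, c p ≠ 0) ∧
      extC K θ = modelEquiv E (WeilPlanes.theta c) := by
  obtain ⟨θ, hθ, c, hc, hext⟩ := A2_inputs_sum D E hconj eK heB hne hspan
  refine ⟨θ, hθ, fun p => c p.1 p.2, fun p => hc p.1 p.2, ?_⟩
  rw [hext]
  exact theta_eq_of_eigenBasis E (fun ν => eK (E.emb (ν, false))) (fun ν => eK (E.emb (ν, true)))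
    (fun i ν => heB i _) (fun i ν => heB i _) c

end Summit.Ventures.HodgeRepro2.T6.A2Inputs
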